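import Literature.AlgebraicGeometry.HodgeTheory.RealSl2BlocksTimesQuaternionProducts
import Literature.AlgebraicGeometry.HodgeTheory.SimpleSurfaceTimesCMCurveStablyNondegenerate
import Literature.AlgebraicGeometry.HodgeTheory.HodgeClassesProductSpanTransport
import Literature.AlgebraicGeometry.ComplexMultiplication.EndAlgebraDegreeDvdTwoDim
import HarnessLib

/-!
# `E × S` is stably nondegenerate for every complex elliptic curve `E` and every simple complex abelian surface `S`, unless `E` and `S` are BOTH of CM type (Moonen–Zarhin 1999 Thm. 0.1 (4) and Thm. (3.2), the threefold rows `E × S`), PROVED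

Family `hodge`, layer `Literature/AlgebraicGeometry/HodgeTheory`. Research context: cell `pub-hodge-ring2`
(HONEST FRAMING: research route conditional on HC_CM; not a corollary; Q11.4-sentence-2 already refuted in
dim ≥ 3), Literature lane (lit seat, generation 52, programmes R16/R15: census form). UNCONDITIONAL; theorems
only, no definition, no named fact, nothing here uses or asserts HC_CM; no step towards a summit statement.

PUBLISHED STATEMENT. Moonen–Zarhin, Math. Ann. 315 (1999), Thm. 0.1: «Let `X` be a complex abelian variety with
`dim(X) ≤ 4`. […] (4) Suppose we are not in one of the cases (a), (b), (c) or (d) [all four of dimension 4].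
Then `Hg(X) = Sp_D(V,φ)` and `B•(Xⁿ) = D•(Xⁿ)` for all `n`» [corpus: paper:arxiv-math_9901113 p. 1]; for
`X = E × S` this is §3 Thm. (3.2): (1) both factors without Type 4 (`E` non-CM: the tree's
`isStablyNondegenerate_curve_prod_of_isSimple_surface`, programme R16), (2) one factor of CM type and the other
without Type 4 (`E` CM, `S` simple not of CM type: `isStablyNondegenerate_prod_cmCurve_of_isSimple_surface_of_not_isOfCMType`,
programme R15). This file assembles the two into the census form: **`B((E × S)ⁿ) = D((E × S)ⁿ)` for all
`n`, for every elliptic curve `E` and every simple abelian surface `S` that are not both of CM type.** (When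
both are of CM type Moonen–Zarhin's (4) still asserts `B = D` — a simple CM surface has a cyclic or non-Galois
quartic CM field of endomorphisms, which contains no imaginary quadratic field — but that CM computation is
not in the tree; nothing is claimed about it here.)

RESULTS (UNCONDITIONAL, no binder).
* `finrank_endAlgebra_eq_one_of_curve_of_not_isOfCMType` — an elliptic curve not of CM type has `End⁰(E) = ℚ`
  (`dim_ℚ End⁰(E) ∣ 2`, and a quadratic `End⁰(E)` is a field of degree `2 = 2 dim E`, i.e. CM type).
* `isStablyNondegenerate_cmCurve_prod_of_isSimple_surface_of_not_isOfCMType` — `E × S` for `E` a CM elliptic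
  curve and `S` simple not of CM type (the product span of `S × E` switched by `HodgeClassesProductSpan.symm`).
* **`isStablyNondegenerate_curve_prod_of_isSimple_surface_of_not_and_isOfCMType (hE : E.dim = 1)
  (hS : S.IsSimple) (hS2 : S.dim = 2) (h : ¬ (IsOfCMType E ∧ IsOfCMType S)) : IsStablyNondegenerate (E.prod S)`**;
  all mixed powers `E^{M+1} × S^{N+1}`, `B = D`, the Hodge conjecture for them and for everything isogenous to
  a power of `E × S`.

## References
* [MoonenZarhin1999LowDim] B. Moonen, Yu. Zarhin, Math. Ann. 315 (1999) 711–733: Thm. 0.1 (4), §2 (2.1)–(2.2),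
  §3 (3.1), Thm. (3.2) [corpus: paper:arxiv-math_9901113 pp. 1, 5–6]. [cite: MoonenZarhin1999LowDim, Thm. 0.1 (4) and §3 Thm. (3.2)]
* [Hazama1989] F. Hazama, Duke Math. J. 58 (1989) 31–37. [cite: Hazama1989, Thm. (= Gordon 7.6.2)]
* [Lombardo2016] D. Lombardo, Algebra Number Theory 10 (2016), Lemma 3.4 (p. 1229). [cite: Lombardo2016, Lemma 3.4 (p. 1229)]
* [MumfordAV1970] D. Mumford, *Abelian Varieties* (1970), §19 Cor. 2 of Thm. 1 (p. 174), §21. [cite: MumfordAV1970, §19 Cor. 2 of Thm. 1 (p. 174)]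
* [Milne1999] J. S. Milne, Compositio Math. 117 (1999), §2 p. 54 (CM type). [cite: Milne1999, §2 p. 54]
* [vanGeemen1994HodgeAV] B. van Geemen, LNM 1594 (1994), §2.4, Lemma 3.7, Thm. 4.3. [cite: vanGeemen1994HodgeAV, Lemma 3.7 and Thm. 4.3]
-/

noncomputable section

open CategoryTheory Module NumberField

namespace Literature.AlgebraicGeometry.HodgeTheory

open Literature.AlgebraicGeometry.Motives (AbelianVariety)
open Literature.AlgebraicGeometry.ComplexMultiplication
open Literature.AlgebraicGeometry.Milne1999
open Literature.Barriers.HodgeConjecture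

variable {E S : AbelianVariety ℂ}

/-- **An elliptic curve NOT of CM type has `End⁰(E) = ℚ`**: `E` is simple, so `dim_ℚ End⁰(E) ∣ 2 dim E = 2`
(`finrank_endAlgebra_dvd_two_mul_dim`); if `dim_ℚ End⁰(E) = 2` then `End⁰(E)` is a (quadratic) field of
degree `2 dim E`, so `E` is of CM type (`isOfCMType_of_isField`) — excluded. Moonen–Zarhin (2.1).
[cite: MoonenZarhin1999LowDim, §2 (2.1)] [cite: MumfordAV1970, §19 Cor. 2 of Thm. 1 (p. 174)] [cite: Milne1999, §2 p. 54] -/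
theorem finrank_endAlgebra_eq_one_of_curve_of_not_isOfCMType (hE : E.dim = 1) (hcm : ¬ IsOfCMType E) :
    Module.finrank ℚ E.endAlgebra = 1 := by
  have h0 : 0 < E.dim := by omega
  have hs : E.IsSimple := AbelianVariety.isSimple_of_dim_le_one hE.le
  haveI : Nontrivial E.endAlgebra := nontrivial_endAlgebra_of_dim_pos h0
  haveI : Module.Finite ℚ E.endAlgebra := AbelianVariety.finiteDimensional_endAlgebra_holds E
  have hdvd : Module.finrank ℚ E.endAlgebra ∣ 2 ^ 1 := by
    have h := finrank_endAlgebra_dvd_two_mul_dim hs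
    rwa [hE] at h
  obtain ⟨k, hk, hfin⟩ := (Nat.dvd_prime_pow Nat.prime_two).1 hdvd
  interval_cases k
  · simpa using hfin
  · exfalso
    have h2 : Module.finrank ℚ E.endAlgebra = 2 := by simpa using hfin
    have hF : IsField E.endAlgebra := AbelianVariety.isField_endAlgebra_of_isSimple_of_finrank_eq_two hs h0 h2
    refine hcm (isOfCMType_of_isField ⊤ ?_ ?_)
    · exact MulEquiv.isField hF
        (Subalgebra.topEquiv : (⊤ : Subalgebra ℚ E.endAlgebra) ≃ₐ[ℚ] E.endAlgebra).toMulEquiv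
    · rw [(Subalgebra.topEquiv : (⊤ : Subalgebra ℚ E.endAlgebra) ≃ₐ[ℚ] E.endAlgebra).toLinearEquiv.finrank_eq, h2, hE]

/-- **`E × S` is stably nondegenerate for `E` a CM elliptic curve and `S` a simple abelian surface NOT of CM
type** (Moonen–Zarhin Thm. (3.2)(2): `S` has no factor of Type 4, `E` is of CM type; the product span of the
tree's R5 on `S^{N+1} × E^{N+1}`, switched to `E^{N+1} × S^{N+1}` by `HodgeClassesProductSpan.symm`, and both
factors satisfy (D)). [cite: MoonenZarhin1999LowDim, §3 Thm. (3.2)(2) and §2 (2.2)] [cite: Lombardo2016, Lemma 3.4 (p. 1229)]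
[cite: vanGeemen1994HodgeAV, Thm. 4.3] -/
theorem isStablyNondegenerate_cmCurve_prod_of_isSimple_surface_of_not_isOfCMType (hE : E.dim = 1)
    (hEcm : IsOfCMType E) (hS : S.IsSimple) (hS2 : S.dim = 2) (hScm : ¬ IsOfCMType S) :
    IsStablyNondegenerate (E.prod S) :=
  isStablyNondegenerate_prod_of_forall_productSpan_powSucc E S
    (fun N => (hodgeClassesProductSpan_powSucc_powSucc_of_hasNoTypeIVFactor
      (hasNoTypeIVFactor_of_isSimple_surface_of_not_isOfCMType hS hS2 hScm) hEcm N N).symm)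
    (EllipticCurve.isStablyNondegenerate hE) (AbelianVariety.isStablyNondegenerate_of_isSimple_surface S hS hS2)

/-- **MOONEN–ZARHIN Thm. 0.1 (4) FOR THE THREEFOLDS `E × S`, PROVED: `E × S` is stably nondegenerate for every
complex elliptic curve `E` and every simple complex abelian surface `S` which are not both of CM type** — every
power `(E × S)^{N+1}` has `B = D`. `E` not of CM type: `End⁰(E) = ℚ` and the tree's R16
`isStablyNondegenerate_curve_prod_of_isSimple_surface` (every simple `S`); `E` of CM type, `S` not:
the previous theorem. UNCONDITIONAL, no binder, nothing assumed about HC_CM.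
[cite: MoonenZarhin1999LowDim, Thm. 0.1 (4) and §3 Thm. (3.2)] [cite: Hazama1989, Thm. (= Gordon 7.6.2)]
[cite: Lombardo2016, Lemma 3.4 (p. 1229)] -/
theorem isStablyNondegenerate_curve_prod_of_isSimple_surface_of_not_and_isOfCMType (hE : E.dim = 1)
    (hS : S.IsSimple) (hS2 : S.dim = 2) (h : ¬ (IsOfCMType E ∧ IsOfCMType S)) :
    IsStablyNondegenerate (E.prod S) := by
  by_cases hEcm : IsOfCMType E
  · exact isStablyNondegenerate_cmCurve_prod_of_isSimple_surface_of_not_isOfCMType hE hEcm hS hS2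
      fun hScm => h ⟨hEcm, hScm⟩
  · exact isStablyNondegenerate_curve_prod_of_isSimple_surface
      (finrank_endAlgebra_eq_one_of_curve_of_not_isOfCMType hE hEcm) hE hS hS2

/-- **All `E^{M+1} × S^{N+1}` are stably nondegenerate** (`E` elliptic, `S` simple surface, not both CM).
[cite: MoonenZarhin1999LowDim, Thm. 0.1 (4) and §3 (3.1)–(3.2)] [cite: Gordon1999HodgeAVSurvey, Def. 7.6] -/
theorem isStablyNondegenerate_powSucc_curve_prod_powSucc_of_isSimple_surface_of_not_and_isOfCMType
    (hE : E.dim = 1) (hS : S.IsSimple) (hS2 : S.dim = 2) (h : ¬ (IsOfCMType E ∧ IsOfCMType S)) (M N : ℕ) :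
    IsStablyNondegenerate ((E.powSucc M).prod (S.powSucc N)) :=
  (isStablyNondegenerate_curve_prod_of_isSimple_surface_of_not_and_isOfCMType hE hS hS2 h).powSucc_prod_powSucc M N

/-- **`B(E^{M+1} × S^{N+1}) = D(E^{M+1} × S^{N+1})`** (`E` elliptic, `S` simple surface, not both CM).
[cite: MoonenZarhin1999LowDim, Thm. 0.1 (4) and §3 (3.1)–(3.2)] -/
theorem isDivisorGenerated_powSucc_curve_prod_powSucc_of_isSimple_surface_of_not_and_isOfCMType
    (hE : E.dim = 1) (hS : S.IsSimple) (hS2 : S.dim = 2) (h : ¬ (IsOfCMType E ∧ IsOfCMType S)) (M N : ℕ) :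
    IsDivisorGenerated ((E.powSucc M).prod (S.powSucc N)) :=
  (isStablyNondegenerate_powSucc_curve_prod_powSucc_of_isSimple_surface_of_not_and_isOfCMType
    hE hS hS2 h M N).isDivisorGenerated

/-- **The Hodge conjecture for every `E^{M+1} × S^{N+1}`** (`E` elliptic, `S` simple surface, not both CM) —
UNCONDITIONAL. [cite: MoonenZarhin1999LowDim, Thm. 0.1 (4) and §2 condition (D)] [cite: vanGeemen1994HodgeAV, §2.4] -/
theorem hodgeConjectureFor_powSucc_curve_prod_powSucc_of_isSimple_surface_of_not_and_isOfCMType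
    (hE : E.dim = 1) (hS : S.IsSimple) (hS2 : S.dim = 2) (h : ¬ (IsOfCMType E ∧ IsOfCMType S)) (M N : ℕ) :
    HodgeConjectureFor ((E.powSucc M).prod (S.powSucc N)).dim ((E.powSucc M).prod (S.powSucc N)).X :=
  (isStablyNondegenerate_powSucc_curve_prod_powSucc_of_isSimple_surface_of_not_and_isOfCMType
    hE hS hS2 h M N).hodgeConjectureFor

/-- **The Hodge conjecture for `E × S` itself** (`E` elliptic, `S` simple surface, not both CM).
[cite: MoonenZarhin1999LowDim, Thm. 0.1 (4)] -/
theorem hodgeConjectureFor_curve_prod_of_isSimple_surface_of_not_and_isOfCMType (hE : E.dim = 1)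
    (hS : S.IsSimple) (hS2 : S.dim = 2) (h : ¬ (IsOfCMType E ∧ IsOfCMType S)) :
    HodgeConjectureFor (E.prod S).dim (E.prod S).X :=
  (isStablyNondegenerate_curve_prod_of_isSimple_surface_of_not_and_isOfCMType hE hS hS2 h).hodgeConjectureFor

/-- **The Hodge conjecture for everything isogenous to a power `(E × S)^{N+1}`** (`E` elliptic, `S` simple
surface, not both CM; van Geemen's Lemma 3.7). [cite: vanGeemen1994HodgeAV, Lemma 3.7] [cite: MoonenZarhin1999LowDim, Thm. 0.1 (4)] -/
theorem hodgeConjectureFor_of_isIsogenous_powSucc_curve_prod_of_isSimple_surface_of_not_and_isOfCMType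
    (hE : E.dim = 1) (hS : S.IsSimple) (hS2 : S.dim = 2) (h : ¬ (IsOfCMType E ∧ IsOfCMType S))
    {X : AbelianVariety ℂ} {N : ℕ} (hX : AbelianVariety.IsIsogenous X ((E.prod S).powSucc N)) :
    HodgeConjectureFor X.dim X.X :=
  (isStablyNondegenerate_curve_prod_of_isSimple_surface_of_not_and_isOfCMType
    hE hS hS2 h).hodgeConjectureFor_of_isIsogenous_powSucc hX

/-- **Isogeny invariance**: everything isogenous to `E × S` (`E` elliptic, `S` simple surface, not both CM)
is stably nondegenerate. [cite: vanGeemen1994HodgeAV, §3.6 (p. 236)] [cite: MoonenZarhin1999LowDim, Thm. 0.1 (4)] -/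
theorem isStablyNondegenerate_of_isIsogenous_curve_prod_of_isSimple_surface_of_not_and_isOfCMType
    (hE : E.dim = 1) (hS : S.IsSimple) (hS2 : S.dim = 2) (h : ¬ (IsOfCMType E ∧ IsOfCMType S))
    {X : AbelianVariety ℂ} (hX : AbelianVariety.IsIsogenous X (E.prod S)) : IsStablyNondegenerate X :=
  (isStablyNondegenerate_curve_prod_of_isSimple_surface_of_not_and_isOfCMType hE hS hS2 h).of_isIsogenous hX

end Literature.AlgebraicGeometry.HodgeTheory
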